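/-
Copyright (c) 2026 the pub-hodgecm-mathlib formalisation cell (harness21).  Prover seat hodgecm-mathlib-K2E4-p11 (g4), Track B ∕ K2-LIT, h413 =
`stmt-HodgeConjecture-24833`, line `K2_E1_TraceFormulaBeta`, campaign «EIS-RANK-ONE» ∕ R8-LADDER-2, deal (ρ3) G2 ∕ «MS-2» bricks (σ3′+σ4′) of K2E1-plan (g5) (RULING «MS-2
SEQUENCED AFTER BL» 2026-09-04T08:43:15Z): THE MAASS–SELBERG RELATION OF THE SPHERICAL SECTION OF `U(1,1)` CONTINUED — hypothesis-first: the two-variable identity theorem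
(holomorphic × antiholomorphic) and pole control of the continued intertwining scalar `c̃` on `½ < Re z ≤ 1`, `Im z ≠ 0`, MODULO ONE named input (the sesqui-holomorphic pairing).
-/
import Summits.HodgeConjecture.HodgeConjecture.Theorems.K2E1MaassSelbergPoleControl       -- ★ p857990: `poleControl_of_fourTerm` (scalar (a1)–(a3) from the diagonal four-term formula)
import Summits.HodgeConjecture.HodgeConjecture.Theorems.K2E1MaassSelbergPoleControlCMTwo  -- ★ p858114: `add_conj_sub_one_eq` (`z + conj z − 1 = 2x`, `z − conj z = 2iy`)
import HarnessLib

/-!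
# h413 ∕ Track B «K2-LIT», R8-LADDER-2 (ρ3) G2 bricks (σ3′+σ4′) — `K2E1MaassSelbergContinuedCMTwo`: the spherical Maass–Selberg relation of `U(1,1)` CONTINUED to
# `½ < Re z` by the identity theorem, and pole control of the continued `c̃` there — modulo the sesqui-holomorphic pairing `Φ` (the one named input, = σ1+σ2 ∕ P8 of the road)

Cell `pub/hodgecm-mathlib`, crux H413 = `stmt-HodgeConjecture-24833`, route `HCCMUnconditional`; dealer K2E1-plan (g5), RULING «MS-2 SEQUENCED AFTER BL» 08:43:15Z (1): «GO (i) NOW: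
HYPOTHESIS-FIRST … it fixes the socket every later brick pays into».  THEOREMS ONLY (no `def`, no `instance`, no `notation`, no `sorry`); ONE named input (`Φ` below, honest:
it is the output of σ1 «(A)-GLOBAL» + σ2 «Λ^T of the continued series», re-sequenced after EIS-R7-BL-SPH-2 P8); lane `--kind proof --supports stmt-HodgeConjecture-24833 --as helper`.
THE MATHEMATICS ([MoeglinWaldspurger1995, IV.2.3, IV.3.12]).  ★ (R6k)₂ `maassSelberg_flatSectionU_cm_two_final_spherical` is the identity
`∫_X Λ^T E(φ₀H^z)·conj Λ^T E(φ₀H^{z′}) dμ = R(z, z′)` on the SUB-TUBE `1 < Re z′ < Re z`, with the explicit four-term right side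
`R(z,z′) = cμ·K·( T^{s₁}∕s₁·κm|φ₀|² + T^{s₂}∕s₂·κm φ₀ conj(c(z′)φ₀) − T^{−s₂}∕s₂·κm c(z)φ₀ conj φ₀ − T^{−s₁}∕s₁·κm c(z)φ₀ conj(c(z′)φ₀) )`, `s₁ = z + conj z′ − 1`, `s₂ = z − conj z′`, `c` the
intertwining scalar.  For the CONTINUED objects — `c̃` holomorphic on a quadrant `D⁺ = {Re > ½, Im > 0}` and the pairing `Φ(z, z′) := ⟨Λ^TẼ(z), Λ^TẼ(z′)⟩` holomorphic in `z`,
antiholomorphic in `z′` there — the identity persists on all of `D⁺ × D⁺` (identity theorem in `z`, then in `conj z′`; on `D⁺ × D⁺` the four-term `R(·;c̃)` has NO singularity: `1 ∉ D⁺`,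
`Im(z − conj z′) > 0`, `Re(z + conj z′ − 1) > 0`), and AT THE DIAGONAL `z′ = z` (`Φ(z,z) = ‖Λ^TẼ(z)‖² ≥ 0`) ★ `poleControl_of_fourTerm` gives (a1) `√b ≤ x·T^{2x}·√a∕|y| + √(…)`,
(a2) the box bound, (a3) `b ≤ C∕y²`, with `a = κm|φ₀|²`, `b = κm|c̃(z)|²|φ₀|²`, `x = Re z − ½ > 0`, `y = Im z` — i.e. **`c̃` HAS NO POLE ON `½ < Re z ≤ 1` OFF THE REAL AXIS and is
`O(|y|⁻¹)` on vertical approach** ([MW] IV.3.12 (a) continued), the input of σ5 (axis non-vanishing, Sarnak) and of «(H4-b)₂-sph-CLOSED».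
* §0 `hasDerivAt_conj_comp_conj`, `differentiableOn_conj_comp_conj` — Schwarz reflection `w ↦ conj(f(conj w))` (antiholomorphy bookkeeping).
* §1 **`eqOn_prod_of_separately_differentiableOn`** — identity theorem for separately holomorphic `F, G : ℂ → ℂ → ℂ` on `D₁ × D₂` (open, preconnected) agreeing on an open box.
* §2 `differentiableOn_fourTerm_fst ∕ _snd_conj` — the four-term `R(z, z′; c̃)` is holomorphic in `z ∈ D⁺` and in `w = conj z′ ∈ D⁻`.
* §3 HEAD **`poleControl_continued_cm_two_of_pairing`** — (a1)∧(a2)∧(a3) for `c̃` at every `z ∈ D⁺`, modulo `Φ`; twin `…_of_pairing_lower` on `D⁻ = {Re > ½, Im < 0}`.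
SOCKET (what the payer must supply, verbatim the binders `hΦ₁ hΦ₂ hrel hQ`): `Φ : ℂ → ℂ → ℂ` with `z ↦ Φ z z′` holomorphic on `D⁺` (`z′ ∈ D⁺`), `w ↦ Φ z (conj w)` holomorphic on `D⁻`
(`z ∈ D⁺`), `Φ = R(·,·;c̃)` on the sub-tube ∩ `D⁺ × D⁺`, and `Φ z z = Q z ≥ 0` — for `Φ(z,z′) = ∫_X Λ^TẼ(z)·conj Λ^TẼ(z′) dμ` these are σ2's dominated-convergence facts and ★ (R6k)₂.
HONEST LABEL.  Count-neutral helper; proves no printed statement; conditional on the named pairing `Φ`; HC_CM is proved only modulo the 7 printed citations (2 remaining named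
inputs: hLiu418 = `stmt-HodgeConjecture-24832`, h413 = `stmt-HodgeConjecture-24833`) until rung 0 closes.

## References
* [MoeglinWaldspurger1995] C. Mœglin, J.-L. Waldspurger, *Spectral decomposition and Eisenstein series* (1995), IV.2.3 (Maass–Selberg), IV.3.12 (a) (pole control; continuation argument).
* [Garrett2018] P. Garrett, *Modern Analysis of Automorphic Forms by Example* 1 (2018), §1.12, §11.3.
* [Arthur1980TraceFormulaII] J. Arthur, *A trace formula for reductive groups II*, Compositio Math. 40 (1980), §4.
-/

set_option autoImplicit false
set_option linter.dupNamespace false  -- the mandated namespace repeats the summit's segment (`HodgeConjecture.HodgeConjecture`)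

noncomputable section

open Filter Topology Set Asymptotics
open scoped ComplexConjugate
open Summit.HodgeConjecture.HodgeConjecture.Cruxes.H413.K2E1MaassSelbergPoleControl (poleControl_of_fourTerm)
open Summit.HodgeConjecture.HodgeConjecture.Cruxes.H413.K2E1MaassSelbergPoleControlCMTwo (add_conj_sub_one_eq)

namespace Summit.HodgeConjecture.HodgeConjecture.Cruxes.H413.K2E1MaassSelbergContinuedCMTwo

/-! ## §0 Schwarz reflection: `w ↦ conj (f (conj w))` -/

section Reflection

/-- **Schwarz reflection for derivatives**: if `f` has derivative `f′` at `conj w` then `w ↦ conj(f(conj w))` has derivative `conj f′` at `w` (conjugation is an isometry commuting with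
the difference quotient up to conjugation). [folklore] -/
theorem hasDerivAt_conj_comp_conj {f : ℂ → ℂ} {f' w : ℂ} (hf : HasDerivAt f f' (conj w)) :
    HasDerivAt (fun u : ℂ => conj (f (conj u))) (conj f') w := by
  rw [hasDerivAt_iff_isLittleO] at hf ⊢
  have h := hf.comp_tendsto (Complex.continuous_conj.tendsto w)
  refine IsLittleO.of_norm_norm ?_
  have h' := h.norm_norm
  refine (h'.congr (fun u => ?_) (fun u => ?_))
  · show ‖f (conj u) - f (conj w) - (conj u - conj w) • f'‖ = ‖conj (f (conj u)) - conj (f (conj w)) - (u - w) • conj f'‖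
    rw [← Complex.norm_conj (f (conj u) - f (conj w) - (conj u - conj w) • f')]
    simp only [smul_eq_mul, map_sub, map_mul, Complex.conj_conj]
  · show ‖conj u - conj w‖ = ‖u - w‖
    rw [← map_sub, Complex.norm_conj]

/-- **Schwarz reflection on sets**: `f` holomorphic on `s` ⟹ `w ↦ conj(f(conj w))` holomorphic on `conj⁻¹ s`. [folklore] -/
theorem differentiableOn_conj_comp_conj {f : ℂ → ℂ} {s : Set ℂ} (hs : IsOpen s) (hf : DifferentiableOn ℂ f s) :
    DifferentiableOn ℂ (fun u : ℂ => conj (f (conj u))) {u : ℂ | conj u ∈ s} := fun _ hu =>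
  (hasDerivAt_conj_comp_conj ((hf.differentiableAt (hs.mem_nhds hu)).hasDerivAt)).differentiableAt.differentiableWithinAt

end Reflection

/-! ## §1 The identity theorem for separately holomorphic functions of two variables -/

section Identity

/-- **IDENTITY THEOREM, TWO VARIABLES, SEPARATELY HOLOMORPHIC.**  `D₁, D₂ ⊆ ℂ` open and preconnected; `F, G : ℂ → ℂ → ℂ` holomorphic in the first variable on `D₁` for each value
of the second in `D₂`, and in the second on `D₂` for each value of the first in `D₁`; if `F = G` on an open box `O₁ × O₂ ⊆ D₁ × D₂` (`Oᵢ` nonempty) then `F = G` on `D₁ × D₂`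
(Mathlib's one-variable identity theorem `AnalyticOnNhd.eqOn_of_preconnected_of_eventuallyEq`, first in `z` for `w ∈ O₂`, then in `w` for every `z ∈ D₁`).
[cite: MoeglinWaldspurger1995, IV.3.12] -/
theorem eqOn_prod_of_separately_differentiableOn {D₁ D₂ O₁ O₂ : Set ℂ} (hD₁ : IsOpen D₁) (hD₁c : IsPreconnected D₁) (hD₂ : IsOpen D₂) (hD₂c : IsPreconnected D₂)
    (hO₁ : IsOpen O₁) (hO₁ne : O₁.Nonempty) (hO₁D : O₁ ⊆ D₁) (hO₂ : IsOpen O₂) (hO₂ne : O₂.Nonempty) (hO₂D : O₂ ⊆ D₂)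
    {F G : ℂ → ℂ → ℂ}
    (hF₁ : ∀ w ∈ D₂, DifferentiableOn ℂ (fun z => F z w) D₁) (hG₁ : ∀ w ∈ D₂, DifferentiableOn ℂ (fun z => G z w) D₁)
    (hF₂ : ∀ z ∈ D₁, DifferentiableOn ℂ (fun w => F z w) D₂) (hG₂ : ∀ z ∈ D₁, DifferentiableOn ℂ (fun w => G z w) D₂)
    (heq : ∀ z ∈ O₁, ∀ w ∈ O₂, F z w = G z w) :
    ∀ z ∈ D₁, ∀ w ∈ D₂, F z w = G z w := by
  -- step 1: for `w ∈ O₂`, `F(·, w) = G(·, w)` on `D₁`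
  obtain ⟨z₀, hz₀⟩ := hO₁ne
  have step1 : ∀ w ∈ O₂, ∀ z ∈ D₁, F z w = G z w := by
    intro w hw
    have hev : (fun z => F z w) =ᶠ[𝓝 z₀] fun z => G z w :=
      Filter.eventually_of_mem (hO₁.mem_nhds hz₀) fun z hz => heq z hz w hw
    exact ((hF₁ w (hO₂D hw)).analyticOnNhd hD₁).eqOn_of_preconnected_of_eventuallyEq ((hG₁ w (hO₂D hw)).analyticOnNhd hD₁) hD₁c (hO₁D hz₀) hev
  -- step 2: for `z ∈ D₁`, `F(z, ·) = G(z, ·)` on `D₂`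
  obtain ⟨w₀, hw₀⟩ := hO₂ne
  intro z hz
  have hev : (fun w => F z w) =ᶠ[𝓝 w₀] fun w => G z w :=
    Filter.eventually_of_mem (hO₂.mem_nhds hw₀) fun w hw => step1 w hw z hz
  exact ((hF₂ z hz).analyticOnNhd hD₂).eqOn_of_preconnected_of_eventuallyEq ((hG₂ z hz).analyticOnNhd hD₂) hD₂c (hO₂D hw₀) hev

end Identity

/-! ## §2 The four-term right side `R(z, z′; c̃)` on the quadrants -/

section FourTerm

/-- The upper quadrant `D⁺ = {Re > ½, Im > 0}` is open. [folklore] -/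
theorem isOpen_upperQuadrant : IsOpen {z : ℂ | 1 / 2 < z.re ∧ 0 < z.im} :=
  (isOpen_lt continuous_const Complex.continuous_re).inter (isOpen_lt continuous_const Complex.continuous_im)

/-- The lower quadrant `D⁻ = {Re > ½, Im < 0}` is open. [folklore] -/
theorem isOpen_lowerQuadrant : IsOpen {w : ℂ | 1 / 2 < w.re ∧ w.im < 0} :=
  (isOpen_lt continuous_const Complex.continuous_re).inter (isOpen_lt Complex.continuous_im continuous_const)

/-- `D⁺` is convex, hence preconnected. [folklore] -/
theorem isPreconnected_upperQuadrant : IsPreconnected {z : ℂ | 1 / 2 < z.re ∧ 0 < z.im} := by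
  have h : Convex ℝ {z : ℂ | 1 / 2 < z.re ∧ 0 < z.im} := by
    have h1 : Convex ℝ {z : ℂ | 1 / 2 < z.re} := convex_halfSpace_gt Complex.reLm.isLinear _
    have h2 : Convex ℝ {z : ℂ | 0 < z.im} := convex_halfSpace_gt Complex.imLm.isLinear _
    exact h1.inter h2
  exact h.isPreconnected

/-- `D⁻` is convex, hence preconnected. [folklore] -/
theorem isPreconnected_lowerQuadrant : IsPreconnected {w : ℂ | 1 / 2 < w.re ∧ w.im < 0} := by
  have h : Convex ℝ {w : ℂ | 1 / 2 < w.re ∧ w.im < 0} := by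
    have h1 : Convex ℝ {w : ℂ | 1 / 2 < w.re} := convex_halfSpace_gt Complex.reLm.isLinear _
    have h2 : Convex ℝ {w : ℂ | w.im < 0} := convex_halfSpace_lt Complex.imLm.isLinear _
    exact h1.inter h2
  exact h.isPreconnected

/-- On `D⁺ × D⁻` (second variable `w = conj z′`): `z + w − 1 ≠ 0` and `z − w ≠ 0`. [folklore] -/
theorem add_sub_one_ne_zero_and_sub_ne_zero {z w : ℂ} (hz : z ∈ {z : ℂ | 1 / 2 < z.re ∧ 0 < z.im}) (hw : w ∈ {w : ℂ | 1 / 2 < w.re ∧ w.im < 0}) : z + w - 1 ≠ 0 ∧ z - w ≠ 0 := by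
  obtain ⟨hz1, hz2⟩ := hz
  obtain ⟨hw1, hw2⟩ := hw
  constructor
  · intro h
    have := congrArg Complex.re h
    simp only [Complex.add_re, Complex.sub_re, Complex.one_re, Complex.zero_re] at this
    linarith
  · intro h
    have := congrArg Complex.im h
    simp only [Complex.sub_im, Complex.zero_im] at this
    linarith

/-- **`R(·, z′; c̃)` is holomorphic in `z ∈ D⁺`** for `z′ ∈ D⁺` and `c̃` holomorphic on `D⁺` (positive base `T`, non-vanishing denominators on `D⁺ × D⁺`). [cite: MoeglinWaldspurger1995, IV.3.12] -/
theorem differentiableOn_fourTerm_fst {T cμ K κ m : ℝ} (hT : 0 < T) (φ₀ : ℂ) {c : ℂ → ℂ} (hc : DifferentiableOn ℂ c {z : ℂ | 1 / 2 < z.re ∧ 0 < z.im}) {z' : ℂ} (hz' : z' ∈ {z : ℂ | 1 / 2 < z.re ∧ 0 < z.im}) :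
    DifferentiableOn ℂ (fun z : ℂ =>
      ((cμ : ℝ) : ℂ) * (((K : ℝ) : ℂ) *
        ((((T : ℝ) : ℂ) ^ (z + conj z' - 1) / (z + conj z' - 1)) * (((κ : ℝ) : ℂ) * (((m : ℝ) : ℂ) * (φ₀ * conj φ₀)))
          + (((T : ℝ) : ℂ) ^ (z - conj z') / (z - conj z')) * (((κ : ℝ) : ℂ) * (((m : ℝ) : ℂ) * (φ₀ * conj (c z' * φ₀))))
          - (((T : ℝ) : ℂ) ^ (-(z - conj z')) / (z - conj z')) * (((κ : ℝ) : ℂ) * (((m : ℝ) : ℂ) * (c z * φ₀ * conj φ₀)))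
          - (((T : ℝ) : ℂ) ^ (-(z + conj z' - 1)) / (z + conj z' - 1)) * (((κ : ℝ) : ℂ) * (((m : ℝ) : ℂ) * (c z * φ₀ * conj (c z' * φ₀))))))) {z : ℂ | 1 / 2 < z.re ∧ 0 < z.im} := by
  have hT0 : ((T : ℝ) : ℂ) ≠ 0 := Complex.ofReal_ne_zero.2 hT.ne'
  have hw : conj z' ∈ {w : ℂ | 1 / 2 < w.re ∧ w.im < 0} := by
    obtain ⟨h1, h2⟩ := hz'
    refine ⟨?_, ?_⟩
    · show 1 / 2 < (conj z').re
      rw [Complex.conj_re]; exact h1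
    · show (conj z').im < 0
      rw [Complex.conj_im]; linarith
  have hne : ∀ z ∈ {z : ℂ | 1 / 2 < z.re ∧ 0 < z.im}, z + conj z' - 1 ≠ 0 ∧ z - conj z' ≠ 0 := fun z hz => add_sub_one_ne_zero_and_sub_ne_zero hz hw
  have hs₁ : DifferentiableOn ℂ (fun z : ℂ => z + conj z' - 1) {z : ℂ | 1 / 2 < z.re ∧ 0 < z.im} := (differentiableOn_id.add_const _).sub_const _
  have hs₂ : DifferentiableOn ℂ (fun z : ℂ => z - conj z') {z : ℂ | 1 / 2 < z.re ∧ 0 < z.im} := differentiableOn_id.sub_const _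
  have e₁ : DifferentiableOn ℂ (fun z : ℂ => ((T : ℝ) : ℂ) ^ (z + conj z' - 1) / (z + conj z' - 1)) {z : ℂ | 1 / 2 < z.re ∧ 0 < z.im} :=
    (hs₁.const_cpow (Or.inl hT0)).div hs₁ fun z hz => (hne z hz).1
  have e₂ : DifferentiableOn ℂ (fun z : ℂ => ((T : ℝ) : ℂ) ^ (z - conj z') / (z - conj z')) {z : ℂ | 1 / 2 < z.re ∧ 0 < z.im} :=
    (hs₂.const_cpow (Or.inl hT0)).div hs₂ fun z hz => (hne z hz).2
  have e₃ : DifferentiableOn ℂ (fun z : ℂ => ((T : ℝ) : ℂ) ^ (-(z - conj z')) / (z - conj z')) {z : ℂ | 1 / 2 < z.re ∧ 0 < z.im} :=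
    (hs₂.neg.const_cpow (Or.inl hT0)).div hs₂ fun z hz => (hne z hz).2
  have e₄ : DifferentiableOn ℂ (fun z : ℂ => ((T : ℝ) : ℂ) ^ (-(z + conj z' - 1)) / (z + conj z' - 1)) {z : ℂ | 1 / 2 < z.re ∧ 0 < z.im} :=
    (hs₁.neg.const_cpow (Or.inl hT0)).div hs₁ fun z hz => (hne z hz).1
  exact (((((e₁.mul_const _).add (e₂.mul_const _)).sub (e₃.mul (((hc.mul_const _).mul_const _).const_mul _ |>.const_mul _))).sub
    (e₄.mul (((hc.mul_const _).mul_const _).const_mul _ |>.const_mul _))).const_mul _).const_mul _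

/-- **`R(z, conj w; c̃)` is holomorphic in `w ∈ D⁻`** for `z ∈ D⁺` (the antiholomorphy of `R` in `z′`; Schwarz reflection §0 for `conj(c̃(z′)) = conj(c̃(conj w))`).
[cite: MoeglinWaldspurger1995, IV.3.12] -/
theorem differentiableOn_fourTerm_snd_conj {T cμ K κ m : ℝ} (hT : 0 < T) (φ₀ : ℂ) {c : ℂ → ℂ} (hc : DifferentiableOn ℂ c {z : ℂ | 1 / 2 < z.re ∧ 0 < z.im}) {z : ℂ} (hz : z ∈ {z : ℂ | 1 / 2 < z.re ∧ 0 < z.im}) :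
    DifferentiableOn ℂ (fun w : ℂ =>
      ((cμ : ℝ) : ℂ) * (((K : ℝ) : ℂ) *
        ((((T : ℝ) : ℂ) ^ (z + w - 1) / (z + w - 1)) * (((κ : ℝ) : ℂ) * (((m : ℝ) : ℂ) * (φ₀ * conj φ₀)))
          + (((T : ℝ) : ℂ) ^ (z - w) / (z - w)) * (((κ : ℝ) : ℂ) * (((m : ℝ) : ℂ) * (φ₀ * conj (c (conj w) * φ₀))))
          - (((T : ℝ) : ℂ) ^ (-(z - w)) / (z - w)) * (((κ : ℝ) : ℂ) * (((m : ℝ) : ℂ) * (c z * φ₀ * conj φ₀)))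
          - (((T : ℝ) : ℂ) ^ (-(z + w - 1)) / (z + w - 1)) * (((κ : ℝ) : ℂ) * (((m : ℝ) : ℂ) * (c z * φ₀ * conj (c (conj w) * φ₀))))))) {w : ℂ | 1 / 2 < w.re ∧ w.im < 0} := by
  have hT0 : ((T : ℝ) : ℂ) ≠ 0 := Complex.ofReal_ne_zero.2 hT.ne'
  have hne : ∀ w ∈ {w : ℂ | 1 / 2 < w.re ∧ w.im < 0}, z + w - 1 ≠ 0 ∧ z - w ≠ 0 := fun w hw => add_sub_one_ne_zero_and_sub_ne_zero hz hw
  have hs₁ : DifferentiableOn ℂ (fun w : ℂ => z + w - 1) {w : ℂ | 1 / 2 < w.re ∧ w.im < 0} := ((differentiableOn_const z).add differentiableOn_id).sub_const _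
  have hs₂ : DifferentiableOn ℂ (fun w : ℂ => z - w) {w : ℂ | 1 / 2 < w.re ∧ w.im < 0} := (differentiableOn_const z).sub differentiableOn_id
  have e₁ : DifferentiableOn ℂ (fun w : ℂ => ((T : ℝ) : ℂ) ^ (z + w - 1) / (z + w - 1)) {w : ℂ | 1 / 2 < w.re ∧ w.im < 0} :=
    (hs₁.const_cpow (Or.inl hT0)).div hs₁ fun w hw => (hne w hw).1
  have e₂ : DifferentiableOn ℂ (fun w : ℂ => ((T : ℝ) : ℂ) ^ (z - w) / (z - w)) {w : ℂ | 1 / 2 < w.re ∧ w.im < 0} :=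
    (hs₂.const_cpow (Or.inl hT0)).div hs₂ fun w hw => (hne w hw).2
  have e₃ : DifferentiableOn ℂ (fun w : ℂ => ((T : ℝ) : ℂ) ^ (-(z - w)) / (z - w)) {w : ℂ | 1 / 2 < w.re ∧ w.im < 0} :=
    (hs₂.neg.const_cpow (Or.inl hT0)).div hs₂ fun w hw => (hne w hw).2
  have e₄ : DifferentiableOn ℂ (fun w : ℂ => ((T : ℝ) : ℂ) ^ (-(z + w - 1)) / (z + w - 1)) {w : ℂ | 1 / 2 < w.re ∧ w.im < 0} :=
    (hs₁.neg.const_cpow (Or.inl hT0)).div hs₁ fun w hw => (hne w hw).1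
  -- the reflected scalar `w ↦ conj (c̃ (conj w) · φ₀)` is holomorphic on `D⁻`
  have hcs : DifferentiableOn ℂ (fun w : ℂ => conj (c (conj w) * φ₀)) {w : ℂ | 1 / 2 < w.re ∧ w.im < 0} := by
    have h := differentiableOn_conj_comp_conj isOpen_upperQuadrant hc
    have hsub : {w : ℂ | 1 / 2 < w.re ∧ w.im < 0} ⊆ {u : ℂ | conj u ∈ {z : ℂ | 1 / 2 < z.re ∧ 0 < z.im}} := fun w hw => by
      obtain ⟨h1, h2⟩ := hw
      refine ⟨?_, ?_⟩
      · show 1 / 2 < (conj w).re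
        rw [Complex.conj_re]; exact h1
      · show 0 < (conj w).im
        rw [Complex.conj_im]; linarith
    have h' : DifferentiableOn ℂ (fun w : ℂ => conj (c (conj w)) * conj φ₀) {w : ℂ | 1 / 2 < w.re ∧ w.im < 0} := (h.mono hsub).mul_const _
    refine h'.congr fun w _ => ?_
    rw [map_mul]
  exact (((((e₁.mul_const _).add (e₂.mul ((hcs.const_mul _).const_mul _ |>.const_mul _))).sub (e₃.mul_const _)).sub
    (e₄.mul ((hcs.const_mul _).const_mul _ |>.const_mul _))).const_mul _).const_mul _

end FourTerm

/-! ## §3 Pole control of the continued intertwining scalar on `½ < Re z`, `Im z ≠ 0`, modulo the pairing -/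

section Head

/-- **(σ3′+σ4′) — THE SPHERICAL MAASS–SELBERG RELATION CONTINUED, AND POLE CONTROL OF `c̃` ON THE UPPER QUADRANT `D⁺ = {Re z > ½, Im z > 0}`, MODULO THE PAIRING `Φ`.**
Data: `T ≥ 1`; positive constants `cμ, K` (★ (R6k)₂), `κ` (the idelic bracket, ★ `idelicBracket_pos`), `m = μ_K(K_U)` (★ `measureReal_maximalCompact_pos`); `φ₀ ≠ 0`; the continued
intertwining scalar `c̃`, holomorphic on `D⁺` (★ W5-B).  NAMED INPUT (σ1+σ2 ∕ P8 of the road, binders `hΦ₁ hΦ₂ hrel hQ`): a pairing `Φ : ℂ → ℂ → ℂ` — to be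
`⟨Λ^TẼ(z), Λ^TẼ(z′)⟩_{L²(X)}` — holomorphic in `z ∈ D⁺`, with `w ↦ Φ z (conj w)` holomorphic on `D⁻` (antiholomorphy in `z′`), equal to the four-term `R(z,z′;c̃)` of ★ (R6k)₂
on the sub-tube `1 < Re z′ < Re z` inside `D⁺ × D⁺`, and real non-negative on the diagonal (`Φ z z = Q z ≥ 0`).  THEN for every `z ∈ D⁺`, with `x = Re z − ½`, `y = Im z`,
`a = κm|φ₀|²`, `b = κm|c̃(z)|²|φ₀|²`: (a1) `√b ≤ x·T^{2x}·√a∕|y| + √(x²T^{4x}a∕y² + aT^{4x})`, (a2) the uniform bound on boxes `x ∈ [x₁,x₂]`, `|y| ≥ η`, (a3) `b ≤ (…)²∕y²` for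
`|y| ≤ 1` — [MW] IV.3.12 (a) for the CONTINUED `c̃` on `½ < Re z ≤ 1` (and again on `Re z > 1`).  Proof: §1 on `D⁺ × D⁻` in the variables `(z, w = conj z′)` (§2 holomorphy; the
box `{3 < Re < 4} × {1 < Re < 2}` of the sub-tube), then the diagonal `w = conj z` and ★ `poleControl_of_fourTerm`. [cite: MoeglinWaldspurger1995, IV.2.3, IV.3.12 (a)]
[cite: Arthur1980TraceFormulaII, §4] [cite: Garrett2018, §1.12, §11.3] -/
theorem poleControl_continued_cm_two_of_pairing {T cμ K κ m : ℝ} (hT : 1 ≤ T) (hcμ : 0 < cμ) (hK : 0 < K) (hκ : 0 < κ) (hm : 0 < m) {φ₀ : ℂ} (hφ₀ : φ₀ ≠ 0)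
    {c : ℂ → ℂ} (hc : DifferentiableOn ℂ c {z : ℂ | 1 / 2 < z.re ∧ 0 < z.im})
    {Φ : ℂ → ℂ → ℂ}
    (hΦ₁ : ∀ z' ∈ {z : ℂ | 1 / 2 < z.re ∧ 0 < z.im}, DifferentiableOn ℂ (fun z : ℂ => Φ z z') {z : ℂ | 1 / 2 < z.re ∧ 0 < z.im})
    (hΦ₂ : ∀ z ∈ {z : ℂ | 1 / 2 < z.re ∧ 0 < z.im}, DifferentiableOn ℂ (fun w : ℂ => Φ z (conj w)) {w : ℂ | 1 / 2 < w.re ∧ w.im < 0})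
    (hrel : ∀ z ∈ {z : ℂ | 1 / 2 < z.re ∧ 0 < z.im}, ∀ z' ∈ {z : ℂ | 1 / 2 < z.re ∧ 0 < z.im}, 1 < z'.re → z'.re < z.re →
      Φ z z' = ((cμ : ℝ) : ℂ) * (((K : ℝ) : ℂ) *
        ((((T : ℝ) : ℂ) ^ (z + conj z' - 1) / (z + conj z' - 1)) * (((κ : ℝ) : ℂ) * (((m : ℝ) : ℂ) * (φ₀ * conj φ₀)))
          + (((T : ℝ) : ℂ) ^ (z - conj z') / (z - conj z')) * (((κ : ℝ) : ℂ) * (((m : ℝ) : ℂ) * (φ₀ * conj (c z' * φ₀))))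
          - (((T : ℝ) : ℂ) ^ (-(z - conj z')) / (z - conj z')) * (((κ : ℝ) : ℂ) * (((m : ℝ) : ℂ) * (c z * φ₀ * conj φ₀)))
          - (((T : ℝ) : ℂ) ^ (-(z + conj z' - 1)) / (z + conj z' - 1)) * (((κ : ℝ) : ℂ) * (((m : ℝ) : ℂ) * (c z * φ₀ * conj (c z' * φ₀)))))))
    {Q : ℂ → ℝ} (hQ : ∀ z ∈ {z : ℂ | 1 / 2 < z.re ∧ 0 < z.im}, 0 ≤ Q z ∧ Φ z z = ((Q z : ℝ) : ℂ))
    {z : ℂ} (hz : z ∈ {z : ℂ | 1 / 2 < z.re ∧ 0 < z.im}) :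
    Real.sqrt (κ * m * ‖c z‖ ^ 2 * ‖φ₀‖ ^ 2) ≤ (z.re - 1 / 2) * T ^ (2 * (z.re - 1 / 2)) * Real.sqrt (κ * m * ‖φ₀‖ ^ 2) / |z.im| +
        Real.sqrt ((z.re - 1 / 2) ^ 2 * T ^ (4 * (z.re - 1 / 2)) * (κ * m * ‖φ₀‖ ^ 2) / z.im ^ 2 + (κ * m * ‖φ₀‖ ^ 2) * T ^ (4 * (z.re - 1 / 2))) ∧
      (∀ {x₁ x₂ η : ℝ}, 0 < x₁ → (z.re - 1 / 2) ∈ Set.Icc x₁ x₂ → 0 < η → η ≤ |z.im| →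
        κ * m * ‖c z‖ ^ 2 * ‖φ₀‖ ^ 2 ≤ (x₂ * T ^ (2 * x₂) * Real.sqrt (κ * m * ‖φ₀‖ ^ 2) / η + Real.sqrt (x₂ ^ 2 * T ^ (4 * x₂) * (κ * m * ‖φ₀‖ ^ 2) / η ^ 2 + (κ * m * ‖φ₀‖ ^ 2) * T ^ (4 * x₂))) ^ 2) ∧
      (|z.im| ≤ 1 → κ * m * ‖c z‖ ^ 2 * ‖φ₀‖ ^ 2 ≤ ((z.re - 1 / 2) * T ^ (2 * (z.re - 1 / 2)) * Real.sqrt (κ * m * ‖φ₀‖ ^ 2) +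
        Real.sqrt ((z.re - 1 / 2) ^ 2 * T ^ (4 * (z.re - 1 / 2)) * (κ * m * ‖φ₀‖ ^ 2) + (κ * m * ‖φ₀‖ ^ 2) * T ^ (4 * (z.re - 1 / 2)))) ^ 2 / z.im ^ 2) := by
  have hT0 : 0 < T := lt_of_lt_of_le one_pos hT
  -- (1) the identity on `D⁺ × D⁻` in the variables `(z, w = conj z′)`
  set F : ℂ → ℂ → ℂ := fun z w => Φ z (conj w) with hF_def
  set G : ℂ → ℂ → ℂ := fun z w =>
      ((cμ : ℝ) : ℂ) * (((K : ℝ) : ℂ) *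
        ((((T : ℝ) : ℂ) ^ (z + w - 1) / (z + w - 1)) * (((κ : ℝ) : ℂ) * (((m : ℝ) : ℂ) * (φ₀ * conj φ₀)))
          + (((T : ℝ) : ℂ) ^ (z - w) / (z - w)) * (((κ : ℝ) : ℂ) * (((m : ℝ) : ℂ) * (φ₀ * conj (c (conj w) * φ₀))))
          - (((T : ℝ) : ℂ) ^ (-(z - w)) / (z - w)) * (((κ : ℝ) : ℂ) * (((m : ℝ) : ℂ) * (c z * φ₀ * conj φ₀)))
          - (((T : ℝ) : ℂ) ^ (-(z + w - 1)) / (z + w - 1)) * (((κ : ℝ) : ℂ) * (((m : ℝ) : ℂ) * (c z * φ₀ * conj (c (conj w) * φ₀)))))) with hG_def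
  have hconjP : ∀ w ∈ {w : ℂ | 1 / 2 < w.re ∧ w.im < 0}, conj w ∈ {z : ℂ | 1 / 2 < z.re ∧ 0 < z.im} := fun w hw => by
    obtain ⟨h1, h2⟩ := hw
    refine ⟨?_, ?_⟩
    · show 1 / 2 < (conj w).re
      rw [Complex.conj_re]; exact h1
    · show 0 < (conj w).im
      rw [Complex.conj_im]; linarith
  have hF₁ : ∀ w ∈ {w : ℂ | 1 / 2 < w.re ∧ w.im < 0}, DifferentiableOn ℂ (fun z => F z w) {z : ℂ | 1 / 2 < z.re ∧ 0 < z.im} := fun w hw => hΦ₁ (conj w) (hconjP w hw)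
  have hG₁ : ∀ w ∈ {w : ℂ | 1 / 2 < w.re ∧ w.im < 0}, DifferentiableOn ℂ (fun z => G z w) {z : ℂ | 1 / 2 < z.re ∧ 0 < z.im} := fun w hw => by
    have h := differentiableOn_fourTerm_fst (cμ := cμ) (K := K) (κ := κ) (m := m) hT0 φ₀ hc (hconjP w hw)
    simp only [Complex.conj_conj] at h
    exact h
  have hF₂ : ∀ z ∈ {z : ℂ | 1 / 2 < z.re ∧ 0 < z.im}, DifferentiableOn ℂ (fun w => F z w) {w : ℂ | 1 / 2 < w.re ∧ w.im < 0} := fun z hz => hΦ₂ z hz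
  have hG₂ : ∀ z ∈ {z : ℂ | 1 / 2 < z.re ∧ 0 < z.im}, DifferentiableOn ℂ (fun w => G z w) {w : ℂ | 1 / 2 < w.re ∧ w.im < 0} := fun z hz =>
    differentiableOn_fourTerm_snd_conj (cμ := cμ) (K := K) (κ := κ) (m := m) hT0 φ₀ hc hz
  -- the box of the sub-tube: `O₁ = {3 < Re < 4, Im > 0}`, `O₂ = {1 < Re < 2, Im < 0}` (so `conj w ∈ D⁺`, `1 < Re (conj w) < Re z`)
  have hO₁ : IsOpen {z : ℂ | (3 < z.re ∧ z.re < 4) ∧ 0 < z.im} :=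
    ((isOpen_lt continuous_const Complex.continuous_re).inter (isOpen_lt Complex.continuous_re continuous_const)).inter (isOpen_lt continuous_const Complex.continuous_im)
  have hO₂ : IsOpen {w : ℂ | (1 < w.re ∧ w.re < 2) ∧ w.im < 0} :=
    ((isOpen_lt continuous_const Complex.continuous_re).inter (isOpen_lt Complex.continuous_re continuous_const)).inter (isOpen_lt Complex.continuous_im continuous_const)
  have hO₁ne : ({z : ℂ | (3 < z.re ∧ z.re < 4) ∧ 0 < z.im} : Set ℂ).Nonempty := ⟨⟨7 / 2, 1⟩, by norm_num⟩
  have hO₂ne : ({w : ℂ | (1 < w.re ∧ w.re < 2) ∧ w.im < 0} : Set ℂ).Nonempty := ⟨⟨3 / 2, -1⟩, by norm_num⟩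
  have hO₁D : {z : ℂ | (3 < z.re ∧ z.re < 4) ∧ 0 < z.im} ⊆ {z : ℂ | 1 / 2 < z.re ∧ 0 < z.im} := fun z hz => ⟨by linarith [hz.1.1], hz.2⟩
  have hO₂D : {w : ℂ | (1 < w.re ∧ w.re < 2) ∧ w.im < 0} ⊆ {w : ℂ | 1 / 2 < w.re ∧ w.im < 0} := fun w hw => ⟨by linarith [hw.1.1], hw.2⟩
  have heq : ∀ z ∈ {z : ℂ | (3 < z.re ∧ z.re < 4) ∧ 0 < z.im}, ∀ w ∈ {w : ℂ | (1 < w.re ∧ w.re < 2) ∧ w.im < 0}, F z w = G z w := by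
    intro z hz w hw
    have h := hrel z (hO₁D hz) (conj w) (hconjP w (hO₂D hw)) (by rw [Complex.conj_re]; exact hw.1.1) (by rw [Complex.conj_re]; linarith [hw.1.2, hz.1.1])
    simp only [Complex.conj_conj] at h
    exact h
  have hid := eqOn_prod_of_separately_differentiableOn isOpen_upperQuadrant isPreconnected_upperQuadrant isOpen_lowerQuadrant isPreconnected_lowerQuadrant
    hO₁ hO₁ne hO₁D hO₂ hO₂ne hO₂D hF₁ hG₁ hF₂ hG₂ heq
  -- (2) the diagonal `w = conj z`
  have hzc : conj z ∈ {w : ℂ | 1 / 2 < w.re ∧ w.im < 0} := by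
    obtain ⟨h1, h2⟩ := hz
    refine ⟨?_, ?_⟩
    · show 1 / 2 < (conj z).re
      rw [Complex.conj_re]; exact h1
    · show (conj z).im < 0
      rw [Complex.conj_im]; linarith
  have hdiag := hid z hz (conj z) hzc
  simp only [hF_def, hG_def, Complex.conj_conj] at hdiag
  obtain ⟨hQ0, hQeq⟩ := hQ z hz
  rw [hQeq] at hdiag
  -- (3) ★ `poleControl_of_fourTerm` with `c₁ = cμ`, `c₂ = K`, `a = κm|φ₀|²`, `b = κm|c̃ z|²|φ₀|²`, `W = κm·φ₀·conj(c̃ z·φ₀)`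
  have hx : 0 < z.re - 1 / 2 := by linarith [hz.1]
  have hy : z.im ≠ 0 := ne_of_gt hz.2
  obtain ⟨hs₁, hs₂⟩ := add_conj_sub_one_eq z
  have hnorm : φ₀ * conj φ₀ = ((‖φ₀‖ ^ 2 : ℝ) : ℂ) := by rw [Complex.mul_conj, Complex.normSq_eq_norm_sq]
  have ha : 0 < κ * m * ‖φ₀‖ ^ 2 := by positivity
  have hb : 0 ≤ κ * m * ‖c z‖ ^ 2 * ‖φ₀‖ ^ 2 := by positivity
  have hB₁ : ((κ : ℝ) : ℂ) * (((m : ℝ) : ℂ) * (φ₀ * conj φ₀)) = ((κ * m * ‖φ₀‖ ^ 2 : ℝ) : ℂ) := by rw [hnorm]; push_cast; ring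
  have hB₃ : ((κ : ℝ) : ℂ) * (((m : ℝ) : ℂ) * (c z * φ₀ * conj φ₀)) = conj (((κ : ℝ) : ℂ) * (((m : ℝ) : ℂ) * (φ₀ * conj (c z * φ₀)))) := by
    simp only [map_mul, Complex.conj_conj, Complex.conj_ofReal]; ring
  have hB₄ : ((κ : ℝ) : ℂ) * (((m : ℝ) : ℂ) * (c z * φ₀ * conj (c z * φ₀))) = ((κ * m * ‖c z‖ ^ 2 * ‖φ₀‖ ^ 2 : ℝ) : ℂ) := by
    have h2 : c z * φ₀ * conj (c z * φ₀) = ((‖c z * φ₀‖ ^ 2 : ℝ) : ℂ) := by rw [Complex.mul_conj, Complex.normSq_eq_norm_sq]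
    rw [h2, norm_mul, mul_pow]; push_cast; ring
  have hW : ‖((κ : ℝ) : ℂ) * (((m : ℝ) : ℂ) * (φ₀ * conj (c z * φ₀)))‖ ^ 2 ≤ (κ * m * ‖φ₀‖ ^ 2) * (κ * m * ‖c z‖ ^ 2 * ‖φ₀‖ ^ 2) := by
    rw [norm_mul, norm_mul, norm_mul, Complex.norm_conj, norm_mul, Complex.norm_real, Complex.norm_real, Real.norm_of_nonneg hκ.le, Real.norm_of_nonneg hm.le]
    nlinarith [norm_nonneg φ₀, norm_nonneg (c z), sq_nonneg (κ * m * ‖φ₀‖ * ‖c z‖ * ‖φ₀‖)]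
  have hfour : (((Q z : ℝ)) : ℂ) = ((cμ : ℝ) : ℂ) * (((K : ℝ) : ℂ) *
      ((((T : ℝ) : ℂ) ^ (z + conj z - 1) / (z + conj z - 1)) * (((κ : ℝ) : ℂ) * (((m : ℝ) : ℂ) * (φ₀ * conj φ₀)))
        + (((T : ℝ) : ℂ) ^ (z - conj z) / (z - conj z)) * (((κ : ℝ) : ℂ) * (((m : ℝ) : ℂ) * (φ₀ * conj (c z * φ₀))))
        - (((T : ℝ) : ℂ) ^ (-(z - conj z)) / (z - conj z)) * (((κ : ℝ) : ℂ) * (((m : ℝ) : ℂ) * (c z * φ₀ * conj φ₀)))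
        - (((T : ℝ) : ℂ) ^ (-(z + conj z - 1)) / (z + conj z - 1)) * (((κ : ℝ) : ℂ) * (((m : ℝ) : ℂ) * (c z * φ₀ * conj (c z * φ₀)))))) := hdiag
  exact poleControl_of_fourTerm hcμ hK hT hx hy hQ0 ha hb hW hs₁ hs₂ hB₁ hB₃ hB₄ hfour

end Head

end Summit.HodgeConjecture.HodgeConjecture.Cruxes.H413.K2E1MaassSelbergContinuedCMTwo

end
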